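import Summits.FinalStateConjecture.FinalStateConjecture.Theses.SwallowTheDatum
import Literature.Geometry.Lorentzian.ModelData
import Literature.Geometry.Lorentzian.ModelDataProofs
import Literature.Geometry.Lorentzian.LeviCivitaProofs
import Literature.Geometry.Lorentzian.PseudoRiemannianMetricProofs
import Literature.Geometry.Lorentzian.KerrDataProofs
import Literature.Geometry.Lorentzian.KerrSchildCoord
import Literature.Geometry.Lorentzian.KerrDataSchwarzschildMetric
import Literature.Geometry.Lorentzian.KerrDataSchwarzschildExtrinsic
import Literature.Geometry.Lorentzian.ChartSecondFundamentalForm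
import Literature.Geometry.Lorentzian.LocalIsometryScalarCurvature
import Literature.Geometry.Lorentzian.IsometryProofs

/-!
# Negative lemmas for the crux `SwallowTheDatum.ParametricKerrBurial`, I — zero-spin shields have
# positive scalar curvature on the unbent zone

Support file (refuter, cdisprove seat of `stmt-FinalStateConjecture-10052`; everything proved,
no definitions, no named facts) for the disproof programme of the crux
`Summit.FinalStateConjecture.FinalStateConjecture.Theses.SwallowTheDatum.ParametricKerrBurial`
(the crux work file `Cruxes/ParametricKerrBurial/Disproof.lean`, §6, states the same results over
its bundled predicates). The crux asks, through every admissible datum, for a jointly smooth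
injective family of admissible data whose `c ≠ 0` members are KERR-SHIELDED: exact bent
Kerr–Schild/Boyer–Lindquist slices of a sub-extremal Kerr outside a compact set, the slice being
the graph `t* = T(r)` with `T ≡ 0` for `r ≤ 4M`. For ZERO SPIN, using only the `h`-clauses:

* `scalarCurvature_zeroSpinShield_unbent` — if `φ^* h = ψ^* g_{M,0}` for the graph `ψ` of a height
  `T` vanishing on `r ≤ 4M` and `φ` is smooth, then on the unbent zone `‖y‖ < 4M` the scalar
  curvature of `h` at `φ y` is Cook's `8M²/(‖y‖²(‖y‖ + 2M)²)` (naturality of the scalar curvature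
  under the local isometry `φ`, `PseudoRiemannianMetric.scalarCurvature_comap`, and the coordinate
  formula `OpensChart.scalarCurvature_eq_coord` for the representative `Kerr.hRep`; Cook 2000
  (55)–(57), O'Neill Prop. 3.59; no `Kerr.SliceFacts` hypothesis is needed);
* `exists_scalarCurvature_eq_of_zeroSpinShield` (`R = 8/(225M²)` at the image of `(0,0,3M)`),
  `exists_scalarCurvature_ge_of_zeroSpinShield` (`R ≥ 1/(2(r₁+1)²)` at the image of a point just
  inside the horizon — a bound by the JUNCTION RADIUS alone);
* `false_of_zeroSpinShield_of_scalarCurvature_nonpos` — **no datum with `R(h) ≤ 0` carries a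
  zero-spin shield** (in particular no scalar-flat datum: time-symmetric vacuum data, flat data);
* `crux_height_eq_zero` — the crux's verbatim zero-spin height vanishes on `r ≤ 4M`.

Part II (`ZeroSpinBurialLimit.lean`) uses these to refute the confined strengthening of the crux
along `c → 0`.

## References

* G. B. Cook, *Initial data for numerical relativity*, Living Rev. Relativ. 3 (2000) 5, §3.2.2,
  (55)–(57). [Cook2000]
* B. O'Neill, *Semi-Riemannian geometry* (1983), Ch. 3, Prop. 3.59, Def. 3.53. [ONeill1983]
-/

noncomputable section

-- instance search through nested operator types `E4 →L E4 →L E4 →L ℝ` (as in the tree files)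
set_option maxSynthPendingDepth 3


namespace Summit.FinalStateConjecture.FinalStateConjecture.Theorems.ParametricKerrBurial.Negative

open Literature.Geometry.Lorentzian
open scoped Manifold ContDiff Topology InnerProductSpace
open Set Bundle Filter

/-! ### The graph of a height vanishing on the unbent zone -/

/-- On `‖z‖ < 4M` the graph representative of a height `T` with `T ≡ 0` on `r ≤ 4M` is the flat
slice embedding `z ↦ (0, z)`, locally. [cite: Cook2000, §3.2.2 (55)] -/
theorem graphRep_eventuallyEq {M : ℝ} {T : ℝ → ℝ} (hT0 : ∀ r, r ≤ 4 * M → T r = 0)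
    {z : E3} (hz : ‖z‖ < 4 * M) :
    (fun z : E3 ↦ E4.ofTimeSpace (T (Kerr.radius 0 (E4.ofTimeSpace 0 z))) z) =ᶠ[𝓝 z]
      E4.ofTimeSpace 0 := by
  have ho : IsOpen {z : E3 | ‖z‖ < 4 * M} := isOpen_lt continuous_norm continuous_const
  filter_upwards [ho.mem_nhds hz] with u hu
  simp only [Kerr.radius_zero_ofTimeSpace]
  rw [hT0 _ (le_of_lt hu)]

/-- Pointwise form of `graphRep_eventuallyEq`. [cite: Cook2000, §3.2.2 (55)] -/
theorem graphRep_apply {M : ℝ} {T : ℝ → ℝ} (hT0 : ∀ r, r ≤ 4 * M → T r = 0)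
    {z : E3} (hz : ‖z‖ < 4 * M) :
    E4.ofTimeSpace (T (Kerr.radius 0 (E4.ofTimeSpace 0 z))) z = E4.ofTimeSpace 0 z :=
  (graphRep_eventuallyEq hT0 hz).self_of_nhds

/-- The graph representative is differentiable on the unbent zone. [folklore] -/
theorem differentiableAt_graphRep {M : ℝ} {T : ℝ → ℝ} (hT0 : ∀ r, r ≤ 4 * M → T r = 0)
    {z : E3} (hz : ‖z‖ < 4 * M) :
    DifferentiableAt ℝ (fun z : E3 ↦ E4.ofTimeSpace (T (Kerr.radius 0 (E4.ofTimeSpace 0 z))) z) z :=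
  (Kerr.hasFDerivAt_ofTimeSpace_zero z).differentiableAt.congr_of_eventuallyEq
    (graphRep_eventuallyEq hT0 hz)

/-- The differential of the graph representative on the unbent zone is `v ↦ (0, v)`. [folklore] -/
theorem fderiv_graphRep {M : ℝ} {T : ℝ → ℝ} (hT0 : ∀ r, r ≤ 4 * M → T r = 0)
    {z : E3} (hz : ‖z‖ < 4 * M) (v : E3) :
    fderiv ℝ (fun z : E3 ↦ E4.ofTimeSpace (T (Kerr.radius 0 (E4.ofTimeSpace 0 z))) z) z v =
      E4.ofTimeSpace 0 v := by
  rw [(graphRep_eventuallyEq hT0 hz).fderiv_eq, Kerr.fderiv_ofTimeSpace_zero]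

/-- On the unbent zone the graph `ψ` IS the Kerr–Schild slice embedding. [cite: Cook2000, §3.2.2 (55)] -/
theorem psi_eq_sliceEmbed {M r₁ : ℝ} {T : ℝ → ℝ} (hT0 : ∀ r, r ≤ 4 * M → T r = 0)
    {ψ : Kerr.slice 0 r₁ → Kerr.region 0 r₁}
    (hψ : ∀ y : Kerr.slice 0 r₁, (ψ y : E4) =
      E4.ofTimeSpace (T (Kerr.radius 0 (E4.ofTimeSpace 0 (y : E3)))) (y : E3))
    {y : Kerr.slice 0 r₁} (hy4 : ‖(y : E3)‖ < 4 * M) :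
    ψ y = Kerr.sliceEmbed 0 r₁ y := by
  apply Subtype.ext
  rw [hψ y, Kerr.coe_sliceEmbed]
  exact graphRep_apply hT0 hy4

/-- … and its differential is `v ↦ (0, v)`. [folklore] -/
theorem mfderiv_psi {M r₁ : ℝ} {T : ℝ → ℝ} (hT0 : ∀ r, r ≤ 4 * M → T r = 0)
    {ψ : Kerr.slice 0 r₁ → Kerr.region 0 r₁}
    (hψ : ∀ y : Kerr.slice 0 r₁, (ψ y : E4) =
      E4.ofTimeSpace (T (Kerr.radius 0 (E4.ofTimeSpace 0 (y : E3)))) (y : E3))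
    {y : Kerr.slice 0 r₁} (hy4 : ‖(y : E3)‖ < 4 * M) (v : E3) :
    mfderiv 𝓘(ℝ, E3) 𝓘(ℝ, E4) ψ y v = E4.ofTimeSpace 0 v := by
  rw [OpensChart.mfderiv_apply_of_repr
    (Φ := fun z : E3 ↦ E4.ofTimeSpace (T (Kerr.radius 0 (E4.ofTimeSpace 0 z))) z) hψ
    (differentiableAt_graphRep hT0 hy4), fderiv_graphRep hT0 hy4]

/-- **`h` of a zero-spin shielded datum on the unbent zone** is Cook's Kerr–Schild slice metric
`hRep M y = ⟪v, w⟫ + (2M/‖y‖³) ⟪y, v⟫⟪y, w⟫`. [cite: Cook2000, §3.2.2 (55)] -/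
theorem h_pullback_eq_hRep [Kerr.Facts] {X : Type*} [TopologicalSpace X] [ChartedSpace E3 X]
    [IsManifold (𝓡 3) ∞ X] (D : InitialDataSet (𝓡 3) X) {M r₁ : ℝ} {T : ℝ → ℝ}
    (hT0 : ∀ r, r ≤ 4 * M → T r = 0)
    {φ : Kerr.slice 0 r₁ → X} {ψ : Kerr.slice 0 r₁ → Kerr.region 0 r₁}
    (hψ : ∀ y : Kerr.slice 0 r₁, (ψ y : E4) =
      E4.ofTimeSpace (T (Kerr.radius 0 (E4.ofTimeSpace 0 (y : E3)))) (y : E3))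
    (hh : ∀ y : Kerr.slice 0 r₁,
      pullbackBilin (I := 𝓡 3) (I' := 𝓘(ℝ, E3)) φ D.h.inner y =
        pullbackBilin (I := 𝓘(ℝ, E4)) (I' := 𝓘(ℝ, E3)) ψ (Kerr.smoothMetric M 0 r₁).val y)
    {y : Kerr.slice 0 r₁} (hy4 : ‖(y : E3)‖ < 4 * M) (v w : E3) :
    D.h.inner (φ y) (mfderiv 𝓘(ℝ, E3) (𝓡 3) φ y v) (mfderiv 𝓘(ℝ, E3) (𝓡 3) φ y w) =
      Kerr.hRep M y v w := by
  have hy : (y : E3) ≠ 0 := Kerr.ne_zero_of_mem_slice_zero y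
  have e : D.h.inner (φ y) (mfderiv 𝓘(ℝ, E3) (𝓡 3) φ y v) (mfderiv 𝓘(ℝ, E3) (𝓡 3) φ y w) =
      (Kerr.smoothMetric M 0 r₁).val (ψ y) (mfderiv 𝓘(ℝ, E3) 𝓘(ℝ, E4) ψ y v)
        (mfderiv 𝓘(ℝ, E3) 𝓘(ℝ, E4) ψ y w) :=
    DFunLike.congr_fun (DFunLike.congr_fun (hh y) v) w
  rw [e, mfderiv_psi hT0 hψ hy4, mfderiv_psi hT0 hψ hy4, Kerr.smoothMetric_val,
    psi_eq_sliceEmbed hT0 hψ hy4, Kerr.coe_sliceEmbed]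
  exact Kerr.bilin_zero_ofTimeSpace M hy v w

/-! ### The scalar curvature on the unbent zone -/

/-- `hRep M y` is positive definite away from the origin for `M ≥ 0`. [cite: Cook2000, §3.2.2 (55)] -/
theorem hRep_pos {M : ℝ} (hM : 0 ≤ M) {y : E3} (hy : y ≠ 0) {v : E3} (hv : v ≠ 0) :
    0 < Kerr.hRep M y v v := by
  rw [Kerr.hRep_apply, real_inner_self_eq_norm_sq]
  have h1 : 0 < ‖v‖ ^ 2 := by positivity
  have h2 : 0 ≤ 2 * M / ‖y‖ ^ 3 * (⟪y, v⟫_ℝ * ⟪y, v⟫_ℝ) := by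
    have := mul_self_nonneg ⟪y, v⟫_ℝ
    positivity
  linarith

/-- **The scalar curvature of a zero-spin shielded datum on the unbent zone.** If `φ^*h = ψ^*g`
for the graph `ψ` of a height vanishing on `r ≤ 4M` and `φ` is smooth, then
`R(h)(φ y) = 8M²/(‖y‖²(‖y‖ + 2M)²)` for every `y` of the slice with `‖y‖ < 4M`.
[cite: Cook2000, §3.2.2 (55)–(57)] [cite: ONeill1983, Ch. 3, Prop. 3.59] -/
theorem scalarCurvature_zeroSpinShield_unbent [Kerr.Facts] {X : Type} [TopologicalSpace X]
    [ChartedSpace E3 X] [IsManifold (𝓡 3) ∞ X] (D : InitialDataSet (𝓡 3) X)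
    [D.metric.HasLeviCivita] {M r₁ : ℝ} (hMpos : 0 < M) {T : ℝ → ℝ}
    (hT0 : ∀ r, r ≤ 4 * M → T r = 0)
    {φ : Kerr.slice 0 r₁ → X} {ψ : Kerr.slice 0 r₁ → Kerr.region 0 r₁}
    (hφ : ContMDiff 𝓘(ℝ, E3) (𝓡 3) ∞ φ)
    (hψ : ∀ y : Kerr.slice 0 r₁, (ψ y : E4) =
      E4.ofTimeSpace (T (Kerr.radius 0 (E4.ofTimeSpace 0 (y : E3)))) (y : E3))
    (hh : ∀ y : Kerr.slice 0 r₁,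
      pullbackBilin (I := 𝓡 3) (I' := 𝓘(ℝ, E3)) φ D.h.inner y =
        pullbackBilin (I := 𝓘(ℝ, E4)) (I' := 𝓘(ℝ, E3)) ψ (Kerr.smoothMetric M 0 r₁).val y)
    {y : Kerr.slice 0 r₁} (hy4 : ‖(y : E3)‖ < 4 * M) :
    D.metric.scalarCurvature (φ y) =
      8 * M ^ 2 / (‖(y : E3)‖ ^ 2 * (‖(y : E3)‖ + 2 * M) ^ 2) := by
  -- the unbent zone as an open subset of `E3`, and its inclusion into the slice
  set W : TopologicalSpace.Opens E3 := ⟨{z : E3 | z ∈ Kerr.slice 0 r₁ ∧ ‖z‖ < 4 * M},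
    (Kerr.slice 0 r₁).2.inter (isOpen_lt continuous_norm continuous_const)⟩ with hWdef
  set ι : W → Kerr.slice 0 r₁ := fun q ↦ ⟨q.1, q.2.1⟩ with hιdef
  have hι : ContMDiff 𝓘(ℝ, E3) 𝓘(ℝ, E3) ∞ ι := by
    rw [← ContMDiff.subtypeVal_comp_iff]
    exact contMDiff_subtype_val
  have hmfι : ∀ q : W, mfderiv 𝓘(ℝ, E3) 𝓘(ℝ, E3) ι q = ContinuousLinearMap.id ℝ E3 := by
    intro q
    have h1 : mfderiv 𝓘(ℝ, E3) 𝓘(ℝ, E3) (Subtype.val ∘ ι) q =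
        (mfderiv 𝓘(ℝ, E3) 𝓘(ℝ, E3) (Subtype.val : Kerr.slice 0 r₁ → E3) (ι q)).comp
          (mfderiv 𝓘(ℝ, E3) 𝓘(ℝ, E3) ι q) :=
      mfderiv_comp q ((contMDiff_subtype_val (n := (1 : ℕ∞ω))).mdifferentiableAt one_ne_zero)
        (hι.mdifferentiableAt (by simp))
    have h2 : mfderiv 𝓘(ℝ, E3) 𝓘(ℝ, E3) (Subtype.val ∘ ι) q =
        ContinuousLinearMap.id ℝ E3 := mfderiv_subtypeVal q
    rw [h2, mfderiv_subtypeVal] at h1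
    rw [h1]
    rfl
  -- the local isometry `Φ = φ ∘ ι : W → X`
  set Φ : W → X := φ ∘ ι with hΦdef
  have hΦ : ContMDiff 𝓘(ℝ, E3) (𝓡 3) (∞ + 1) Φ := hφ.comp hι
  have hmf : ∀ q : W, mfderiv 𝓘(ℝ, E3) (𝓡 3) Φ q = mfderiv 𝓘(ℝ, E3) (𝓡 3) φ (ι q) := fun q ↦ by
    rw [hΦdef, mfderiv_comp q (hφ.mdifferentiableAt (by simp)) (hι.mdifferentiableAt (by simp)),
      hmfι]
    exact ContinuousLinearMap.comp_id _
  have hval : ∀ q : W, ∀ v w : E3,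
      pullbackBilin (I := 𝓡 3) (I' := 𝓘(ℝ, E3)) Φ D.metric.val q v w = Kerr.hRep M q v w := by
    intro q v w
    rw [pullbackBilin_apply, hmf q, InitialDataSet.val_metric]
    exact h_pullback_eq_hRep D hT0 hψ hh (y := ι q) q.2.2 v w
  have hΦ' : ∀ q, Function.Injective (mfderiv 𝓘(ℝ, E3) (𝓡 3) Φ q) := by
    intro q v w hvw
    have hq0 : (q : E3) ≠ 0 := Kerr.ne_zero_of_mem_slice_zero (ι q)
    have h0 : mfderiv 𝓘(ℝ, E3) (𝓡 3) Φ q (v - w) = 0 := by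
      rw [ContinuousLinearMap.map_sub, hvw, sub_self]
    have hzero : Kerr.hRep M q (v - w) (v - w) = 0 := by
      rw [← hval q, pullbackBilin_apply, h0]
      simp
    by_contra hne
    exact (hRep_pos hMpos.le hq0 (sub_ne_zero.2 hne)).ne' hzero
  set G := D.metric.comap (PseudoRiemannianMetric.contMDiff_pullbackBilin_holds
    (I := 𝓡 3) (M := X) (I' := 𝓘(ℝ, E3)) (N := W)) Φ hΦ hΦ' rfl with hGdef
  haveI := G.hasLeviCivita
  have hG : ∀ q : W, G.val q = Kerr.hRep M q := fun q ↦
    ContinuousLinearMap.ext fun v ↦ ContinuousLinearMap.ext fun w ↦ hval q v w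
  -- naturality
  set q₀ : W := ⟨(y : E3), y.2, hy4⟩ with hq₀
  have hnat : G.scalarCurvature q₀ = D.metric.scalarCurvature (Φ q₀) :=
    PseudoRiemannianMetric.scalarCurvature_comap D.metric _ hΦ hΦ' rfl q₀
  have hΦq₀ : Φ q₀ = φ y := by
    simp only [hΦdef, Function.comp_apply, hιdef, hq₀]
  rw [← hΦq₀, ← hnat]
  -- the coordinate computation (verbatim the proof of `Kerr.scalarCurvature_data_zero`)
  have hy : (y : E3) ≠ 0 := Kerr.ne_zero_of_mem_slice_zero y
  have hr : ‖(y : E3)‖ ≠ 0 := norm_ne_zero_iff.2 hy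
  have hrM : ‖(y : E3)‖ + 2 * M ≠ 0 := by
    have := Kerr.norm_pos_of_mem_slice_zero y; positivity
  obtain ⟨b, hb⟩ := Kerr.exists_orthonormalBasis_adapted hy
  set β : Module.Basis (Fin 3) ℝ (TangentSpace 𝓘(ℝ, E3) q₀) := b.toBasis with hβdef
  have hβ : ∀ i, β i = b i := fun i ↦ congrFun b.coe_toBasis i
  rw [OpensChart.scalarCurvature_eq_coord hG q₀ β]
  simp only [hβ]
  show _ = 8 * M ^ 2 / (‖(y : E3)‖ ^ 2 * (‖(y : E3)‖ + 2 * M) ^ 2)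
  have hq₀E : ((q₀ : W) : E3) = (y : E3) := rfl
  simp only [hq₀E]
  rw [Kerr.gram_hRep_adapted_inv hy b hb hrM]
  simp only [Kerr.koszulForm_hRep M hy, Kerr.fderiv_koszulForm_hRep M hy]
  simp only [Matrix.diagonal_apply, ite_mul, zero_mul, Finset.sum_ite_eq', Finset.mem_univ,
    if_true]
  simp only [Kerr.cKS_adapted b hb, Kerr.dcKS_adapted b hb, Kerr.inner_adapted b hb,
    Kerr.inner_basis b, Fin.sum_univ_three, Fin.isValue, Matrix.cons_val_zero,
    Matrix.cons_val_one, Matrix.cons_val,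
    if_true, show ((0 : Fin 3) = 2) = False by decide, show ((1 : Fin 3) = 2) = False by decide,
    show ((0 : Fin 3) = 1) = False by decide, show ((1 : Fin 3) = 0) = False by decide,
    show ((2 : Fin 3) = 0) = False by decide, show ((2 : Fin 3) = 1) = False by decide, if_false,
    mul_zero, zero_mul, mul_one, one_mul, add_zero, zero_add, sub_zero]
  field_simp
  ring

/-- **A zero-spin shield produces a point with `R(h) = 8/(225M²)`**: the image of the test point
`(0,0,3M)` of the unbent zone (`r₁ < r₊ = 2M < 3M < 4M`). [cite: Cook2000, §3.2.2 (55)–(57)] -/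
theorem exists_scalarCurvature_eq_of_zeroSpinShield [Kerr.Facts] {X : Type} [TopologicalSpace X]
    [ChartedSpace E3 X] [IsManifold (𝓡 3) ∞ X] (D : InitialDataSet (𝓡 3) X)
    [D.metric.HasLeviCivita] {M r₁ : ℝ} (hMpos : 0 < M) (hr₁ : r₁ < Kerr.rPlus M 0)
    {T : ℝ → ℝ} (hT0 : ∀ r, r ≤ 4 * M → T r = 0)
    {φ : Kerr.slice 0 r₁ → X} {ψ : Kerr.slice 0 r₁ → Kerr.region 0 r₁}
    (hφ : ContMDiff 𝓘(ℝ, E3) (𝓡 3) ∞ φ)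
    (hψ : ∀ y : Kerr.slice 0 r₁, (ψ y : E4) =
      E4.ofTimeSpace (T (Kerr.radius 0 (E4.ofTimeSpace 0 (y : E3)))) (y : E3))
    (hh : ∀ y : Kerr.slice 0 r₁,
      pullbackBilin (I := 𝓡 3) (I' := 𝓘(ℝ, E3)) φ D.h.inner y =
        pullbackBilin (I := 𝓘(ℝ, E4)) (I' := 𝓘(ℝ, E3)) ψ (Kerr.smoothMetric M 0 r₁).val y) :
    ∃ y : Kerr.slice 0 r₁, ‖(y : E3)‖ < 4 * M ∧
      D.metric.scalarCurvature (φ y) = 8 / (225 * M ^ 2) := by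
  set y₀E : E3 := (3 * M) • EuclideanSpace.single (2 : Fin 3) (1 : ℝ) with hy₀E
  have hnorm : ‖y₀E‖ = 3 * M := by
    rw [hy₀E, norm_smul, PiLp.norm_single, Real.norm_eq_abs, norm_one, mul_one,
      abs_of_pos (by positivity)]
  have hmem : y₀E ∈ Kerr.slice 0 r₁ := by
    rw [Kerr.mem_slice_zero_iff, hnorm]
    have : r₁ < 2 * M := by rwa [Kerr.rPlus_zero_right hMpos.le] at hr₁
    exact max_lt (by linarith) (by positivity)
  set y₀ : Kerr.slice 0 r₁ := ⟨y₀E, hmem⟩ with hy₀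
  have hy4 : ‖(y₀ : E3)‖ < 4 * M := by
    show ‖y₀E‖ < 4 * M
    rw [hnorm]; linarith
  have key := scalarCurvature_zeroSpinShield_unbent D hMpos hT0 hφ hψ hh hy4
  have hn : ‖(y₀ : E3)‖ = 3 * M := hnorm
  rw [hn] at key
  refine ⟨y₀, hy4, ?_⟩
  rw [key]
  field_simp
  ring

/-- **A zero-spin shield produces a point with `R(h) ≥ 1/(2(r₁+1)²)` controlled by the JUNCTION
RADIUS alone**: the image of the point at Kerr–Schild radius `r = r₁ + min 1 ((2M − r₁)/2)`
(inside the horizon, where `R = 8M²/(r²(r+2M)²) ≥ 1/(2r²)`). [cite: Cook2000, §3.2.2 (55)–(57)] -/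
theorem exists_scalarCurvature_ge_of_zeroSpinShield [Kerr.Facts] {X : Type} [TopologicalSpace X]
    [ChartedSpace E3 X] [IsManifold (𝓡 3) ∞ X] (D : InitialDataSet (𝓡 3) X)
    [D.metric.HasLeviCivita] {M r₁ : ℝ} (hMpos : 0 < M) (hr₁pos : 0 < r₁)
    (hr₁ : r₁ < Kerr.rPlus M 0) {T : ℝ → ℝ} (hT0 : ∀ r, r ≤ 4 * M → T r = 0)
    {φ : Kerr.slice 0 r₁ → X} {ψ : Kerr.slice 0 r₁ → Kerr.region 0 r₁}
    (hφ : ContMDiff 𝓘(ℝ, E3) (𝓡 3) ∞ φ)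
    (hψ : ∀ y : Kerr.slice 0 r₁, (ψ y : E4) =
      E4.ofTimeSpace (T (Kerr.radius 0 (E4.ofTimeSpace 0 (y : E3)))) (y : E3))
    (hh : ∀ y : Kerr.slice 0 r₁,
      pullbackBilin (I := 𝓡 3) (I' := 𝓘(ℝ, E3)) φ D.h.inner y =
        pullbackBilin (I := 𝓘(ℝ, E4)) (I' := 𝓘(ℝ, E3)) ψ (Kerr.smoothMetric M 0 r₁).val y) :
    ∃ y : Kerr.slice 0 r₁, ‖(y : E3)‖ < 4 * M ∧
      1 / (2 * (r₁ + 1) ^ 2) ≤ D.metric.scalarCurvature (φ y) := by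
  have hr₁M : r₁ < 2 * M := by rwa [Kerr.rPlus_zero_right hMpos.le] at hr₁
  set δ : ℝ := min 1 ((2 * M - r₁) / 2) with hδ
  have hδpos : 0 < δ := lt_min one_pos (by linarith)
  have hδ1 : δ ≤ 1 := min_le_left _ _
  have hδ2 : δ ≤ (2 * M - r₁) / 2 := min_le_right _ _
  set r : ℝ := r₁ + δ with hr
  have hrpos : 0 < r := by positivity
  have hr2M : r < 2 * M := by linarith
  set yE : E3 := r • EuclideanSpace.single (2 : Fin 3) (1 : ℝ) with hyE
  have hnorm : ‖yE‖ = r := by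
    rw [hyE, norm_smul, PiLp.norm_single, Real.norm_eq_abs, norm_one, mul_one, abs_of_pos hrpos]
  have hmem : yE ∈ Kerr.slice 0 r₁ := by
    rw [Kerr.mem_slice_zero_iff, hnorm]
    exact max_lt (by linarith) hrpos
  set y : Kerr.slice 0 r₁ := ⟨yE, hmem⟩ with hy
  have hy4 : ‖(y : E3)‖ < 4 * M := by
    show ‖yE‖ < 4 * M
    rw [hnorm]; linarith
  have key := scalarCurvature_zeroSpinShield_unbent D hMpos hT0 hφ hψ hh hy4
  have hn : ‖(y : E3)‖ = r := hnorm
  rw [hn] at key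
  refine ⟨y, hy4, ?_⟩
  rw [key]
  have h1 : r ^ 2 ≤ (r₁ + 1) ^ 2 := by nlinarith
  have h2 : (r + 2 * M) ^ 2 ≤ 16 * M ^ 2 := by nlinarith
  have h3 : r ^ 2 * (r + 2 * M) ^ 2 ≤ (r₁ + 1) ^ 2 * (16 * M ^ 2) :=
    mul_le_mul h1 h2 (by positivity) (by positivity)
  rw [div_le_div_iff₀ (by positivity) (by positivity)]
  nlinarith [h3]

/-- **No datum with `R(h) ≤ 0` everywhere carries a zero-spin shield** — in particular no
scalar-flat datum (every time-symmetric vacuum datum, every datum with `|k|² = (tr k)²`, flat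
data). [cite: Cook2000, §3.2.2 (55)–(57)] -/
theorem false_of_zeroSpinShield_of_scalarCurvature_nonpos [Kerr.Facts] {X : Type}
    [TopologicalSpace X] [ChartedSpace E3 X] [IsManifold (𝓡 3) ∞ X]
    (D : InitialDataSet (𝓡 3) X) [D.metric.HasLeviCivita]
    (hD : ∀ x, D.metric.scalarCurvature x ≤ 0) {M r₁ : ℝ} (hMpos : 0 < M)
    (hr₁ : r₁ < Kerr.rPlus M 0) {T : ℝ → ℝ} (hT0 : ∀ r, r ≤ 4 * M → T r = 0)
    {φ : Kerr.slice 0 r₁ → X} {ψ : Kerr.slice 0 r₁ → Kerr.region 0 r₁}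
    (hφ : ContMDiff 𝓘(ℝ, E3) (𝓡 3) ∞ φ)
    (hψ : ∀ y : Kerr.slice 0 r₁, (ψ y : E4) =
      E4.ofTimeSpace (T (Kerr.radius 0 (E4.ofTimeSpace 0 (y : E3)))) (y : E3))
    (hh : ∀ y : Kerr.slice 0 r₁,
      pullbackBilin (I := 𝓡 3) (I' := 𝓘(ℝ, E3)) φ D.h.inner y =
        pullbackBilin (I := 𝓘(ℝ, E4)) (I' := 𝓘(ℝ, E3)) ψ (Kerr.smoothMetric M 0 r₁).val y) :
    False := by
  obtain ⟨y, -, hy⟩ := exists_scalarCurvature_eq_of_zeroSpinShield D hMpos hr₁ hT0 hφ hψ hh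
  have hpos : 0 < D.metric.scalarCurvature (φ y) := by rw [hy]; positivity
  exact absurd hpos (not_lt.2 (hD _))

/-- **The crux's verbatim zero-spin height vanishes on the unbent zone** (`Real.smoothTransition`
vanishes on `(-∞, 0]`), so every zero-spin shield of `ParametricKerrBurial` satisfies the
hypothesis `hT0` of the lemmas of this file. [folklore] -/
theorem crux_height_eq_zero {M : ℝ} (hM : 0 < M) (r : ℝ) (hr : r ≤ 4 * M) :
    (fun r : ℝ => Real.smoothTransition (r / (4 * M) - 1) *
      (((M) / Real.sqrt ((M) ^ 2 - (0 : ℝ) ^ 2)) *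
        (Kerr.rPlus M 0 * Real.log (r - Kerr.rPlus M 0) -
          Kerr.rMinus M 0 * Real.log (r - Kerr.rMinus M 0)) -
      ((M) / Real.sqrt ((M) ^ 2 - (0 : ℝ) ^ 2)) *
        (Kerr.rPlus M 0 * Real.log ((4 * M) - Kerr.rPlus M 0) -
          Kerr.rMinus M 0 * Real.log ((4 * M) - Kerr.rMinus M 0)))) r = 0 := by
  have h4 : (0 : ℝ) < 4 * M := by positivity
  have : r / (4 * M) - 1 ≤ 0 := by
    rw [sub_nonpos, div_le_one h4]; exact hr
  simp only [Real.smoothTransition.zero_of_nonpos this, zero_mul]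

end Summit.FinalStateConjecture.FinalStateConjecture.Theorems.ParametricKerrBurial.Negative

end
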